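import Literature.Topology.FourManifolds.RegularLevelCollar
import Literature.Topology.FourManifolds.NeckCapping
import Literature.Topology.FourManifolds.ConnectedSumSummands
import Literature.Topology.FourManifolds.SmoothEmbeddingCriteria
import HarnessLib

/-!
# A regular level sphere splits a closed manifold as a connected sum

Topic `Literature/Topology/FourManifolds` (brick (P2b)/(P3, 4-d)/(P4) of the road to the named fact
`Literature.Topology.FourManifolds.Trisection.isConnectedSum_of_reducing_separating`,
`ReducibleTrisectionSplitting.lean`, § Status: once the trisected reducing sphere is produced as a
regular level `σ⁻¹(0) ≅ S³`, the neck, the two sides and the connected-sum witness are the content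
of this file; and a general Morse-theoretic tool).  **Everything here is proved; no named fact is
introduced.**

Let `M` be a compact Hausdorff manifold without boundary modelled on `ℝⁿ⁺¹` (`𝓡 (n + 1)`),
`f : M → ℝ` smooth, and suppose the level `f⁻¹(a)` is regular (it carries a unit-speed field
`U : LevelUnitField n f a`, which is how the tree's product neighbourhood theorem
`RegularLevelCollar.lean` — Milnor, *Morse theory* (1963), Thm. 3.1; *h-cobordism* (1965),
Thm. 3.4 — is phrased; `IsRegularLevel.exists_levelUnitField`) and is the image of a smooth
embedding `e : 𝕊ⁿ ↪ M` of the round sphere.  Then: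

* §1 `squash δ : ℝ → (-δ, δ)`, `t ↦ δ t / √(1 + t²)`, a diffeomorphism with inverse
  `unsquash δ s = s / √(δ² - s²)`, `sign (squash δ t) = sign t`;
* §2 **the level neck** `LevelUnitField.sphereNeck U e (θ, t) = fl (e θ) (squash δ t)` (flow of the
  unit field for the squashed time): a smooth embedding `𝕊ⁿ × ℝ ↪ M` with range the open band
  `f⁻¹(a - δ, a + δ)`, `sphereNeck (θ, 0) = e θ`, and **`f (sphereNeck (θ, t)) = a + squash δ t`**
  (`apply_sphereNeck`), so the neck crosses the level upwards;
* §3 **the two sides as neck-cap data** (`NeckCapping.lean`): `U.upperCap` with side `{a < f}` for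
  the neck and `U.lowerCap` with side `{f < a}` for the flipped neck; they are disjoint and cover
  `M` off the level, hence (`NeckCapData.isConnectedSum_capped`, Hamilton 1997 §1.1 / Kosinski VI §1)
  **`M` is the connected sum of the two capped sides**
  (`LevelUnitField.isConnectedSum_capped`:
  `IsConnectedSum (𝓡 (n+1)) (𝓡 (n+1)) (𝓡 (n+1)) U.upperCap.Capped U.lowerCap.Capped M`), both capped
  sides being compact Hausdorff second countable smooth manifolds, connected when `M` is;
* §4 the packaged statement over `IsRegularLevel`
  (`IsRegularLevel.exists_isConnectedSum_of_sphere_level`): a closed manifold with a regular level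
  diffeomorphic (as an embedded sphere) to `𝕊ⁿ` is a connected sum `M₁ # M₂` of closed manifolds
  into which the open sides `{a < f}`, `{f < a}` embed as complements of a point.

This is the folklore "cut along a two-sided sphere and cap off with discs" (Kervaire–Milnor 1963,
§2; Kosinski, *Differential Manifolds*, VI §1–2: a manifold containing a neck `Sⁿ × ℝ` whose middle
sphere separates is the connected sum of the capped sides), in the level-set idiom in which the
tree expresses two-sidedness of hypersurfaces (`SphereHypersurfaceSides.lean`,
`RegularLevelTwoSides.lean`).  For the reducing-sphere road (§ Status of
`ReducibleTrisectionSplitting.lean`, design note (a)): with the reducing sphere `S = σ⁻¹(0)` a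
regular level and `e : S³ ↪ X` onto it, §3 gives the neck `ψ`, the sides `{σ > 0}`, `{σ < 0}` as
`NeckCapData 3 ψ`, and `IsConnectedSum (𝓡 4) (𝓡 4) (𝓡 4) X₁ X₂ X` for the capped sides, with no
appeal to simple connectivity (`exists_two_sides_of_neck` is not used).

## References

* J. Milnor, *Morse theory*, Ann. of Math. Studies 51 (1963), Thm. 3.1. [Milnor1963]
* J. Milnor, *Lectures on the h-cobordism theorem* (1965), Thm. 3.4. [MilnorHCobordism1965]
* M. Kervaire, J. Milnor, *Groups of homotopy spheres I*, Ann. of Math. 77 (1963), §2.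
  [KervaireMilnor1963]
* A. Kosinski, *Differential Manifolds* (1993), Ch. VI §1 (Prop. 1.3), §2. [Kosinski1993]
* R. Hamilton, *Four-manifolds with positive isotropic curvature*, Comm. Anal. Geom. 5 (1997),
  §1.1. [Hamilton1997]
-/

open scoped Manifold ContDiff Topology
open Set Function Metric Module

noncomputable section

universe u

namespace Literature.Topology.FourManifolds

/-- Local notation: `𝔼 n` is the model Euclidean space `EuclideanSpace ℝ (Fin n)`. -/
local notation "𝔼 " n:arg => EuclideanSpace ℝ (Fin n)

/-- Local notation: `𝕊 n` is the unit sphere in `EuclideanSpace ℝ (Fin (n + 1))`. -/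
local notation "𝕊 " n:arg => (Metric.sphere (0 : EuclideanSpace ℝ (Fin (n + 1))) 1)

-- `dim ℝⁿ⁺¹ = n + 1` as a `Fact` (the class keying Mathlib's sphere charts and the tree's
-- `NeckCapData`): the tree's theorem `fact_finrank_euclideanSpace_succ` (`ClosedBall.lean`), used
-- as a local instance in this file.
attribute [local instance] fact_finrank_euclideanSpace_succ

/-! ### §1 The diffeomorphism `ℝ ≅ (-δ, δ)` -/

namespace LevelSphere

/-- `squash δ t = δ t / √(1 + t²)`, a diffeomorphism of `ℝ` onto `(-δ, δ)` (`δ > 0`). [folklore] -/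
def squash (δ t : ℝ) : ℝ := δ * t / √(1 + t ^ 2)

/-- `unsquash δ s = s / √(δ² - s²)`, the inverse of `squash δ` on `(-δ, δ)`. [folklore] -/
def unsquash (δ s : ℝ) : ℝ := s / √(δ ^ 2 - s ^ 2)

/-- `1 + t² > 0`. [folklore] -/
private theorem one_add_sq_pos (t : ℝ) : 0 < 1 + t ^ 2 := by positivity

/-- `√(1 + t²) > 0`. [folklore] -/
private theorem sqrt_one_add_sq_pos (t : ℝ) : 0 < √(1 + t ^ 2) := Real.sqrt_pos.2 (one_add_sq_pos t)

/-- `squash δ 0 = 0`. [folklore] -/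
@[simp] theorem squash_zero (δ : ℝ) : squash δ 0 = 0 := by simp [squash]

/-- `squash` is smooth. [folklore] -/
theorem contDiff_squash (δ : ℝ) : ContDiff ℝ ∞ (squash δ) := by
  unfold squash
  refine (contDiff_const.mul contDiff_id).div ?_ fun t => (sqrt_one_add_sq_pos t).ne'
  exact (contDiff_const.add (contDiff_id.pow 2)).sqrt fun t => (one_add_sq_pos t).ne'

/-- `|t| < √(1 + t²)`. [folklore] -/
theorem abs_lt_sqrt_one_add_sq (t : ℝ) : |t| < √(1 + t ^ 2) := by
  rw [← Real.sqrt_sq_eq_abs]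
  exact Real.sqrt_lt_sqrt (sq_nonneg t) (by linarith)

/-- `|squash δ t| < δ` for `δ > 0`. [folklore] -/
theorem abs_squash_lt {δ : ℝ} (hδ : 0 < δ) (t : ℝ) : |squash δ t| < δ := by
  unfold squash
  have hr := sqrt_one_add_sq_pos t
  rw [abs_div, abs_mul, abs_of_pos hδ, abs_of_pos hr, div_lt_iff₀ hr]
  have := abs_lt_sqrt_one_add_sq t
  nlinarith

/-- `squash δ t ∈ (-δ, δ)`. [folklore] -/
theorem squash_mem_Ioo {δ : ℝ} (hδ : 0 < δ) (t : ℝ) : squash δ t ∈ Ioo (-δ) δ :=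
  abs_lt.1 (abs_squash_lt hδ t)

/-- `squash δ t > 0 ↔ t > 0`. [folklore] -/
theorem squash_pos_iff {δ : ℝ} (hδ : 0 < δ) {t : ℝ} : 0 < squash δ t ↔ 0 < t := by
  unfold squash
  rw [div_pos_iff_of_pos_right (sqrt_one_add_sq_pos t), mul_pos_iff_of_pos_left hδ]

/-- `squash δ t ≤ 0 ↔ t ≤ 0`. [folklore] -/
theorem squash_nonpos_iff {δ : ℝ} (hδ : 0 < δ) {t : ℝ} : squash δ t ≤ 0 ↔ t ≤ 0 := by
  rw [← not_lt, squash_pos_iff hδ, not_lt]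

/-- `squash δ t < 0 ↔ t < 0`. [folklore] -/
theorem squash_neg_iff {δ : ℝ} (hδ : 0 < δ) {t : ℝ} : squash δ t < 0 ↔ t < 0 := by
  unfold squash
  rw [div_neg_iff]
  have hr := sqrt_one_add_sq_pos t
  constructor
  · rintro (⟨h1, h2⟩ | ⟨h1, h2⟩)
    · exact absurd h2 (not_lt.2 hr.le)
    · nlinarith
  · intro ht
    exact Or.inr ⟨by nlinarith, hr⟩

/-- `unsquash δ (squash δ t) = t`. [folklore] -/
theorem unsquash_squash {δ : ℝ} (hδ : 0 < δ) (t : ℝ) : unsquash δ (squash δ t) = t := by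
  unfold unsquash squash
  have hr := sqrt_one_add_sq_pos t
  have hr2 : √(1 + t ^ 2) ^ 2 = 1 + t ^ 2 := Real.sq_sqrt (one_add_sq_pos t).le
  have key : δ ^ 2 - (δ * t / √(1 + t ^ 2)) ^ 2 = (δ / √(1 + t ^ 2)) ^ 2 := by
    field_simp
    rw [hr2]
    ring
  rw [key, Real.sqrt_sq (div_pos hδ hr).le]
  field_simp

/-- `squash δ (unsquash δ s) = s` for `|s| < δ`. [folklore] -/
theorem squash_unsquash {δ : ℝ} (hδ : 0 < δ) {s : ℝ} (hs : s ∈ Ioo (-δ) δ) :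
    squash δ (unsquash δ s) = s := by
  unfold unsquash squash
  have hq2 : 0 < δ ^ 2 - s ^ 2 := by
    have : |s| < δ := abs_lt.2 hs
    have h' : s ^ 2 < δ ^ 2 := by
      rw [← sq_abs s]
      exact pow_lt_pow_left₀ this (abs_nonneg s) two_ne_zero
    linarith
  have hq := Real.sqrt_pos.2 hq2
  have hq2' : √(δ ^ 2 - s ^ 2) ^ 2 = δ ^ 2 - s ^ 2 := Real.sq_sqrt hq2.le
  have key : 1 + (s / √(δ ^ 2 - s ^ 2)) ^ 2 = (δ / √(δ ^ 2 - s ^ 2)) ^ 2 := by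
    field_simp
    rw [hq2']
    ring
  rw [key, Real.sqrt_sq (div_pos hδ hq).le]
  field_simp

/-- `squash δ` is injective. [folklore] -/
theorem squash_injective {δ : ℝ} (hδ : 0 < δ) : Injective (squash δ) := fun s t hst => by
  rw [← unsquash_squash hδ s, hst, unsquash_squash hδ t]

/-- `unsquash δ` is smooth on `(-δ, δ)`. [folklore] -/
theorem contDiffOn_unsquash (δ : ℝ) : ContDiffOn ℝ ∞ (unsquash δ) (Ioo (-δ) δ) := by
  have hpos : ∀ s ∈ Ioo (-δ) δ, 0 < δ ^ 2 - s ^ 2 := fun s hs => by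
    have h1 : |s| < δ := abs_lt.2 hs
    have hδ : 0 < δ := lt_of_le_of_lt (abs_nonneg s) h1
    have h' : s ^ 2 < δ ^ 2 := by
      rw [← sq_abs s]
      exact pow_lt_pow_left₀ h1 (abs_nonneg s) two_ne_zero
    linarith
  unfold unsquash
  refine contDiffOn_id.div ?_ fun s hs => (Real.sqrt_pos.2 (hpos s hs)).ne'
  exact (contDiffOn_const.sub (contDiffOn_id.pow 2)).sqrt fun s hs => (hpos s hs).ne'

end LevelSphere

open LevelSphere

/-! ### §2 The level neck of a level sphere -/

namespace LevelUnitField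

variable {n : ℕ} {M : Type u} [TopologicalSpace M] [T2Space M] [CompactSpace M]
  [ChartedSpace (𝔼 (n + 1)) M] [IsManifold (𝓡 (n + 1)) ∞ M]
  {f : M → ℝ} {a : ℝ} (U : LevelUnitField n f a) (e : 𝕊 n → M)

/-- **The level neck** of a level sphere `e : 𝕊ⁿ → f⁻¹(a)`: flow the point `e θ` of the level
for the squashed time `squash δ t ∈ (-δ, δ)` along the unit-speed field (Milnor 1963, proof of
Thm. 3.1: the diffeomorphism `f⁻¹(a) × (-δ, δ) ≅ f⁻¹(a - δ, a + δ)`).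
[cite: Milnor1963, Thm. 3.1 and its proof] -/
def sphereNeck (q : (𝕊 n) × ℝ) : M := U.fl (e q.1) (squash U.δ q.2)

/-- The level neck, as a formula (definitional). [cite: Milnor1963, Thm. 3.1 and its proof] -/
theorem sphereNeck_apply (q : (𝕊 n) × ℝ) : U.sphereNeck e q = U.fl (e q.1) (squash U.δ q.2) := rfl

/-- The middle sphere of the level neck is the given level sphere. [cite: Milnor1963, Thm. 3.1 and its proof] -/
@[simp] theorem sphereNeck_zero (θ : 𝕊 n) : U.sphereNeck e (θ, 0) = e θ := by
  simp [sphereNeck_apply]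

/-- **The clock along the level neck**: `f (sphereNeck (θ, t)) = a + squash δ t`.
[cite: Milnor1963, Thm. 3.1 and its proof] -/
theorem apply_sphereNeck (he : ∀ θ, f (e θ) = a) (θ : 𝕊 n) (t : ℝ) :
    f (U.sphereNeck e (θ, t)) = a + squash U.δ t :=
  U.apply_fl_of_apply_eq (he θ) (squash_mem_Ioo U.δ_pos t)

/-- Above the middle sphere `f > a`. [cite: Milnor1963, Thm. 3.1 and its proof] -/
theorem lt_apply_sphereNeck (he : ∀ θ, f (e θ) = a) (θ : 𝕊 n) {t : ℝ} (ht : 0 < t) :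
    a < f (U.sphereNeck e (θ, t)) := by
  rw [U.apply_sphereNeck e he]
  linarith [(squash_pos_iff U.δ_pos).2 ht]

/-- Below (and on) the middle sphere `f ≤ a`. [cite: Milnor1963, Thm. 3.1 and its proof] -/
theorem apply_sphereNeck_le (he : ∀ θ, f (e θ) = a) (θ : 𝕊 n) {t : ℝ} (ht : t ≤ 0) :
    f (U.sphereNeck e (θ, t)) ≤ a := by
  rw [U.apply_sphereNeck e he]
  linarith [(squash_nonpos_iff U.δ_pos).2 ht]

/-- Strictly below the middle sphere `f < a`. [cite: Milnor1963, Thm. 3.1 and its proof] -/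
theorem apply_sphereNeck_lt (he : ∀ θ, f (e θ) = a) (θ : 𝕊 n) {t : ℝ} (ht : t < 0) :
    f (U.sphereNeck e (θ, t)) < a := by
  rw [U.apply_sphereNeck e he]
  linarith [(squash_neg_iff U.δ_pos).2 ht]

/-- On and above the middle sphere `a ≤ f`. [cite: Milnor1963, Thm. 3.1 and its proof] -/
theorem le_apply_sphereNeck (he : ∀ θ, f (e θ) = a) (θ : 𝕊 n) {t : ℝ} (ht : 0 ≤ t) :
    a ≤ f (U.sphereNeck e (θ, t)) := by
  rcases ht.eq_or_lt with rfl | ht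
  · rw [U.sphereNeck_zero e, he]
  · exact (U.lt_apply_sphereNeck e he θ ht).le

/-- The level neck is smooth (for the product model `(𝓡 n).prod 𝓘(ℝ, ℝ)` of `𝕊ⁿ × ℝ`).
[cite: Milnor1963, Thm. 3.1 and its proof] -/
theorem contMDiff_sphereNeck (hec : ContMDiff (𝓡 n) (𝓡 (n + 1)) ∞ e) :
    ContMDiff ((𝓡 n).prod 𝓘(ℝ, ℝ)) (𝓡 (n + 1)) ∞ (U.sphereNeck e) := by
  have h1 : ContMDiff ((𝓡 n).prod 𝓘(ℝ, ℝ)) (𝓡 (n + 1)) ∞ fun q : (𝕊 n) × ℝ => e q.1 :=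
    hec.comp contMDiff_fst
  have h2 : ContMDiff ((𝓡 n).prod 𝓘(ℝ, ℝ)) 𝓘(ℝ, ℝ) ∞ fun q : (𝕊 n) × ℝ => squash U.δ q.2 :=
    (contDiff_squash U.δ).contMDiff.comp contMDiff_snd
  exact U.contMDiff_fl.comp (h1.prodMk h2)

/-- The level neck is continuous. [cite: Milnor1963, Thm. 3.1 and its proof] -/
theorem continuous_sphereNeck (hec : ContMDiff (𝓡 n) (𝓡 (n + 1)) ∞ e) :
    Continuous (U.sphereNeck e) :=
  (U.contMDiff_sphereNeck e hec).continuous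

/-- The level neck lies in the open band `f⁻¹(a - δ, a + δ)`. [cite: Milnor1963, Thm. 3.1 and its proof] -/
theorem sphereNeck_mem_band (he : ∀ θ, f (e θ) = a) (q : (𝕊 n) × ℝ) : U.sphereNeck e q ∈ U.band :=
  U.fl_mem_band (he q.1) (squash_mem_Ioo U.δ_pos q.2)

/-- The level neck is injective (the level sphere being injective). [cite: Milnor1963, Thm. 3.1 and its proof] -/
theorem injective_sphereNeck (he : ∀ θ, f (e θ) = a) (hinj : Injective e) :
    Injective (U.sphereNeck e) := by
  rintro ⟨θ, t⟩ ⟨θ', t'⟩ hq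
  have h := U.fl_injOn (mk_mem_prod (show e θ ∈ f ⁻¹' {a} from he θ) (squash_mem_Ioo U.δ_pos t))
    (mk_mem_prod (show e θ' ∈ f ⁻¹' {a} from he θ') (squash_mem_Ioo U.δ_pos t')) hq
  simp only [Prod.mk.injEq] at h
  rw [Prod.mk.injEq]
  exact ⟨hinj h.1, squash_injective U.δ_pos h.2⟩

/-- **The range of the level neck is the open band**, when the level sphere fills the level.
[cite: Milnor1963, Thm. 3.1 and its proof] -/
theorem range_sphereNeck (he : range e = f ⁻¹' {a}) : range (U.sphereNeck e) = U.band := by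
  have he' : ∀ θ, f (e θ) = a := fun θ => by
    have : e θ ∈ f ⁻¹' {a} := he ▸ mem_range_self θ
    exact this
  apply Subset.antisymm
  · rintro _ ⟨q, rfl⟩
    exact U.sphereNeck_mem_band e he' q
  · intro x hx
    have hdrop : U.drop x ∈ range e := by rw [he]; exact U.drop_mem_level hx
    obtain ⟨θ, hθ⟩ := hdrop
    have hs : f x - a ∈ Ioo (-U.δ) U.δ := ⟨by linarith [hx.1], by linarith [hx.2]⟩
    refine ⟨(θ, unsquash U.δ (f x - a)), ?_⟩
    rw [sphereNeck_apply, squash_unsquash U.δ_pos hs, hθ, U.fl_drop]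

/-- The inverse of the level neck on the band: drop to the level, invert the level sphere, and
unsquash the height `f - a`. [cite: Milnor1963, Thm. 3.1 and its proof] -/
def sphereNeckInv (x : M) : (𝕊 n) × ℝ :=
  haveI : Nonempty (𝕊 n) := ⟨unitSpherePoint n⟩
  (invFun e (U.drop x), unsquash U.δ (f x - a))

/-- `sphereNeckInv ∘ sphereNeck = id`. [cite: Milnor1963, Thm. 3.1 and its proof] -/
theorem sphereNeckInv_sphereNeck (he : ∀ θ, f (e θ) = a) (hinj : Injective e) (q : (𝕊 n) × ℝ) :
    U.sphereNeckInv e (U.sphereNeck e q) = q := by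
  haveI : Nonempty (𝕊 n) := ⟨unitSpherePoint n⟩
  obtain ⟨θ, t⟩ := q
  have hdrop : U.drop (U.sphereNeck e (θ, t)) = e θ :=
    U.drop_fl_of_apply_eq (he θ) (squash_mem_Ioo U.δ_pos t)
  have hf : f (U.sphereNeck e (θ, t)) - a = squash U.δ t := by
    rw [U.apply_sphereNeck e he]; ring
  simp only [sphereNeckInv, hdrop, hf, leftInverse_invFun hinj θ, unsquash_squash U.δ_pos]

/-- `sphereNeck ∘ sphereNeckInv = id` on the band. [cite: Milnor1963, Thm. 3.1 and its proof] -/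
theorem sphereNeck_sphereNeckInv (he : range e = f ⁻¹' {a}) {x : M} (hx : x ∈ U.band) :
    U.sphereNeck e (U.sphereNeckInv e x) = x := by
  haveI : Nonempty (𝕊 n) := ⟨unitSpherePoint n⟩
  have hdrop : U.drop x ∈ range e := by rw [he]; exact U.drop_mem_level hx
  have hs : f x - a ∈ Ioo (-U.δ) U.δ := ⟨by linarith [hx.1], by linarith [hx.2]⟩
  simp only [sphereNeckInv, sphereNeck_apply, invFun_eq hdrop, squash_unsquash U.δ_pos hs]
  exact U.fl_drop x

/-- **The inverse of the level neck is smooth on the band**: the inverse of the level sphere is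
smooth on the level (`contMDiffOn_leftInverse_of_isImmersion`), the drop is smooth, and `unsquash`
is smooth on `(-δ, δ)`. [cite: Milnor1963, Thm. 3.1 and its proof] -/
theorem contMDiffOn_sphereNeckInv (hemb : Manifold.IsSmoothEmbedding (𝓡 n) (𝓡 (n + 1)) ∞ e)
    (he : range e = f ⁻¹' {a}) :
    ContMDiffOn (𝓡 (n + 1)) ((𝓡 n).prod 𝓘(ℝ, ℝ)) ∞ (U.sphereNeckInv e) U.band := by
  haveI : Nonempty (𝕊 n) := ⟨unitSpherePoint n⟩
  have hinv : ContMDiffOn (𝓡 (n + 1)) (𝓡 n) ∞ (invFun e) (range e) :=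
    contMDiffOn_leftInverse_of_isImmersion hemb.isImmersion hemb.isEmbedding
      (leftInverse_invFun hemb.isEmbedding.injective)
  have h1 : ContMDiffOn (𝓡 (n + 1)) (𝓡 n) ∞ (fun x => invFun e (U.drop x)) U.band := by
    refine hinv.comp U.contMDiff_drop.contMDiffOn fun x hx => ?_
    show U.drop x ∈ range e
    rw [he]; exact U.drop_mem_level hx
  have h2 : ContMDiffOn (𝓡 (n + 1)) 𝓘(ℝ, ℝ) ∞ (fun x => unsquash U.δ (f x - a)) U.band := by
    have hu : ContMDiffOn 𝓘(ℝ, ℝ) 𝓘(ℝ, ℝ) ∞ (unsquash U.δ) (Ioo (-U.δ) U.δ) :=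
      (contDiffOn_unsquash U.δ).contMDiffOn
    refine hu.comp (U.contMDiff_f.sub contMDiff_const).contMDiffOn fun x hx => ?_
    exact ⟨by linarith [hx.1], by linarith [hx.2]⟩
  exact h1.prodMk h2

/-- The level neck as an open partial homeomorphism `𝕊ⁿ × ℝ ≅ f⁻¹(a - δ, a + δ)`.
[cite: Milnor1963, Thm. 3.1 and its proof] -/
def sphereNeckPH (hemb : Manifold.IsSmoothEmbedding (𝓡 n) (𝓡 (n + 1)) ∞ e)
    (he : range e = f ⁻¹' {a}) : OpenPartialHomeomorph ((𝕊 n) × ℝ) M where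
  toFun := U.sphereNeck e
  invFun := U.sphereNeckInv e
  source := univ
  target := U.band
  map_source' q _ := by rw [← U.range_sphereNeck e he]; exact mem_range_self q
  map_target' _ _ := mem_univ _
  left_inv' q _ :=
    U.sphereNeckInv_sphereNeck e (fun θ => show e θ ∈ f ⁻¹' {a} from he ▸ mem_range_self θ)
      hemb.isEmbedding.injective q
  right_inv' _ hx := U.sphereNeck_sphereNeckInv e he hx
  open_source := isOpen_univ
  open_target := U.isOpen_band
  continuousOn_toFun := (U.continuous_sphereNeck e hemb.contMDiff).continuousOn
  continuousOn_invFun := (U.contMDiffOn_sphereNeckInv e hemb he).continuousOn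

/-- `dim (ℝⁿ × ℝ) = dim ℝⁿ⁺¹`. [folklore] -/
theorem finrank_euclideanSpace_prod_real (n : ℕ) : finrank ℝ ((𝔼 n) × ℝ) = finrank ℝ (𝔼 (n + 1)) := by
  rw [Module.finrank_prod, finrank_euclideanSpace_fin, finrank_euclideanSpace_fin, Module.finrank_self]

/-- **The level neck is a smooth embedding** `𝕊ⁿ × ℝ ↪ M` (a globally defined partial
diffeomorphism, `isSmoothEmbedding_of_openPartialHomeomorph`). [cite: Milnor1963, Thm. 3.1 and its proof] -/
theorem isSmoothEmbedding_sphereNeck (hemb : Manifold.IsSmoothEmbedding (𝓡 n) (𝓡 (n + 1)) ∞ e)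
    (he : range e = f ⁻¹' {a}) :
    Manifold.IsSmoothEmbedding ((𝓡 n).prod 𝓘(ℝ, ℝ)) (𝓡 (n + 1)) ∞ (U.sphereNeck e) :=
  isSmoothEmbedding_of_openPartialHomeomorph (I := (𝓡 n).prod 𝓘(ℝ, ℝ)) (J := 𝓡 (n + 1))
    (U.sphereNeckPH e hemb he) rfl (U.contMDiff_sphereNeck e hemb.contMDiff).contMDiffOn
    (U.contMDiffOn_sphereNeckInv e hemb he)
    (ContinuousLinearEquiv.ofFinrankEq (finrank_euclideanSpace_prod_real n))

/-- The level neck has open range (the open band). [cite: Milnor1963, Thm. 3.1 and its proof] -/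
theorem isOpen_range_sphereNeck (he : range e = f ⁻¹' {a}) : IsOpen (range (U.sphereNeck e)) := by
  rw [U.range_sphereNeck e he]; exact U.isOpen_band

/-! ### §3 The two sides as neck-cap data, and the connected sum -/

/-- **The upper side `{a < f}` of the level neck, as neck-cap data** (`NeckCapping.lean`): it is
open, contains the upper half-neck (`f = a + squash δ t > a` for `t > 0`), misses the closed lower
half-neck, and `{a < f} ∪ (middle sphere) = {a ≤ f}` is closed.
[cite: Kosinski1993, Ch. VI §1 (p. 90; Prop. 1.3)] -/
def upperCap (hemb : Manifold.IsSmoothEmbedding (𝓡 n) (𝓡 (n + 1)) ∞ e)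
    (he : range e = f ⁻¹' {a}) : NeckCapData n (U.sphereNeck e) where
  isSmoothEmbedding := U.isSmoothEmbedding_sphereNeck e hemb he
  isOpen_range := U.isOpen_range_sphereNeck e he
  side := ⟨{x | a < f x}, isOpen_lt continuous_const U.contMDiff_f.continuous⟩
  isClosed_side_union := by
    have he' : ∀ θ, f (e θ) = a := fun θ => show e θ ∈ f ⁻¹' {a} from he ▸ mem_range_self θ
    have hset : ({x | a < f x} ∪ U.sphereNeck e '' (univ ×ˢ {0}) : Set M) = {x | a ≤ f x} := by
      apply Subset.antisymm
      · rintro x (hx | ⟨⟨θ, t⟩, ⟨-, ht⟩, rfl⟩)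
        · exact le_of_lt (show a < f x from hx)
        · rw [mem_singleton_iff] at ht
          subst ht
          rw [U.sphereNeck_zero e, mem_setOf_eq, he']
      · intro x hx
        rcases (show a ≤ f x from hx).eq_or_lt with hxa | hxa
        · have hxr : x ∈ range e := by rw [he]; exact hxa.symm
          obtain ⟨θ, rfl⟩ := hxr
          exact Or.inr ⟨(θ, 0), ⟨mem_univ _, rfl⟩, U.sphereNeck_zero e θ⟩
        · exact Or.inl hxa
    change IsClosed ({x | a < f x} ∪ U.sphereNeck e '' (univ ×ˢ {0}))
    rw [hset]
    exact isClosed_le continuous_const U.contMDiff_f.continuous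
  image_Ioi_subset := by
    have he' : ∀ θ, f (e θ) = a := fun θ => show e θ ∈ f ⁻¹' {a} from he ▸ mem_range_self θ
    rintro _ ⟨⟨θ, t⟩, ⟨-, ht⟩, rfl⟩
    exact U.lt_apply_sphereNeck e he' θ ht
  not_mem_side := by
    have he' : ∀ θ, f (e θ) = a := fun θ => show e θ ∈ f ⁻¹' {a} from he ▸ mem_range_self θ
    intro θ t ht h
    exact absurd (U.apply_sphereNeck_le e he' θ ht) (not_le.2 h)

/-- The side of `upperCap` is `{a < f}` (definitional). [folklore] -/
@[simp] theorem coe_upperCap_side (hemb : Manifold.IsSmoothEmbedding (𝓡 n) (𝓡 (n + 1)) ∞ e)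
    (he : range e = f ⁻¹' {a}) : ((U.upperCap e hemb he).side : Set M) = {x | a < f x} := rfl

/-- **The lower side `{f < a}`, as neck-cap data for the flipped level neck**
`(θ, t) ↦ sphereNeck (θ, -t)`. [cite: Kosinski1993, Ch. VI §1 (p. 90; Prop. 1.3)] -/
def lowerCap (hemb : Manifold.IsSmoothEmbedding (𝓡 n) (𝓡 (n + 1)) ∞ e)
    (he : range e = f ⁻¹' {a}) :
    NeckCapData n (fun q : (𝕊 n) × ℝ => U.sphereNeck e (q.1, -q.2)) where
  isSmoothEmbedding := isSmoothEmbedding_neck_flip (U.isSmoothEmbedding_sphereNeck e hemb he)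
  isOpen_range := by
    rw [range_neck_flip]
    exact U.isOpen_range_sphereNeck e he
  side := ⟨{x | f x < a}, isOpen_lt U.contMDiff_f.continuous continuous_const⟩
  isClosed_side_union := by
    have he' : ∀ θ, f (e θ) = a := fun θ => show e θ ∈ f ⁻¹' {a} from he ▸ mem_range_self θ
    have hset : ({x | f x < a} ∪ (fun q : (𝕊 n) × ℝ => U.sphereNeck e (q.1, -q.2)) '' (univ ×ˢ {0}) :
        Set M) = {x | f x ≤ a} := by
      apply Subset.antisymm
      · rintro x (hx | ⟨⟨θ, t⟩, ⟨-, ht⟩, rfl⟩)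
        · exact le_of_lt (show f x < a from hx)
        · rw [mem_singleton_iff] at ht
          subst ht
          simp only [neg_zero, U.sphereNeck_zero e, mem_setOf_eq, he', le_refl]
      · intro x hx
        rcases (show f x ≤ a from hx).eq_or_lt with hxa | hxa
        · have hxr : x ∈ range e := by rw [he]; exact hxa
          obtain ⟨θ, rfl⟩ := hxr
          exact Or.inr ⟨(θ, 0), ⟨mem_univ _, rfl⟩, by simp only [neg_zero, U.sphereNeck_zero e]⟩
        · exact Or.inl hxa
    change IsClosed ({x | f x < a} ∪
      (fun q : (𝕊 n) × ℝ => U.sphereNeck e (q.1, -q.2)) '' (univ ×ˢ {0}))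
    rw [hset]
    exact isClosed_le U.contMDiff_f.continuous continuous_const
  image_Ioi_subset := by
    have he' : ∀ θ, f (e θ) = a := fun θ => show e θ ∈ f ⁻¹' {a} from he ▸ mem_range_self θ
    rintro _ ⟨⟨θ, t⟩, ⟨-, ht⟩, rfl⟩
    exact U.apply_sphereNeck_lt e he' θ (neg_lt_zero.2 ht)
  not_mem_side := by
    have he' : ∀ θ, f (e θ) = a := fun θ => show e θ ∈ f ⁻¹' {a} from he ▸ mem_range_self θ
    intro θ t ht h
    exact absurd (U.le_apply_sphereNeck e he' θ (neg_nonneg.2 ht)) (not_le.2 h)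

/-- The side of `lowerCap` is `{f < a}` (definitional). [folklore] -/
@[simp] theorem coe_lowerCap_side (hemb : Manifold.IsSmoothEmbedding (𝓡 n) (𝓡 (n + 1)) ∞ e)
    (he : range e = f ⁻¹' {a}) : ((U.lowerCap e hemb he).side : Set M) = {x | f x < a} := rfl

/-- The two sides are disjoint. [folklore] -/
theorem disjoint_upperCap_lowerCap (hemb : Manifold.IsSmoothEmbedding (𝓡 n) (𝓡 (n + 1)) ∞ e)
    (he : range e = f ⁻¹' {a}) :
    Disjoint ((U.upperCap e hemb he).side : Set M) (U.lowerCap e hemb he).side := by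
  rw [coe_upperCap_side, coe_lowerCap_side, Set.disjoint_left]
  intro x hx hx'
  exact lt_asymm (show a < f x from hx) (show f x < a from hx')

/-- Off the two sides lies only the middle sphere. [folklore] -/
theorem exists_sphereNeck_zero_eq (hemb : Manifold.IsSmoothEmbedding (𝓡 n) (𝓡 (n + 1)) ∞ e)
    (he : range e = f ⁻¹' {a}) (p : M) (h₁ : p ∉ (U.upperCap e hemb he).side)
    (h₂ : p ∉ (U.lowerCap e hemb he).side) : ∃ θ : 𝕊 n, U.sphereNeck e (θ, 0) = p := by
  have h₁' : ¬ a < f p := h₁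
  have h₂' : ¬ f p < a := h₂
  have hp : f p = a := le_antisymm (not_lt.1 h₁') (not_lt.1 h₂')
  have hpr : p ∈ range e := by rw [he]; exact hp
  obtain ⟨θ, rfl⟩ := hpr
  exact ⟨θ, U.sphereNeck_zero e θ⟩

/-- **A closed manifold is the connected sum of the two capped sides of a level sphere**:
`M ≅ M₊ # M₋`, `M₊ = {a < f} ∪ cap`, `M₋ = {f < a} ∪ cap` (`NeckCapData.isConnectedSum_capped`;
Kosinski VI §1, Kervaire–Milnor §2). [cite: Kosinski1993, Ch. VI §1 (p. 90; Prop. 1.3)]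
[cite: KervaireMilnor1963, §2] -/
theorem isConnectedSum_capped (hemb : Manifold.IsSmoothEmbedding (𝓡 n) (𝓡 (n + 1)) ∞ e)
    (he : range e = f ⁻¹' {a}) :
    IsConnectedSum (𝓡 (n + 1)) (𝓡 (n + 1)) (𝓡 (n + 1)) (U.upperCap e hemb he).Capped
      (U.lowerCap e hemb he).Capped M :=
  (U.upperCap e hemb he).isConnectedSum_capped (U.lowerCap e hemb he) (fun _ _ => rfl)
    (U.disjoint_upperCap_lowerCap e hemb he) (U.exists_sphereNeck_zero_eq e hemb he)

/-- The upper capped side of a connected `M` is connected. [folklore] -/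
theorem connectedSpace_upperCap_capped [ConnectedSpace M]
    (hemb : Manifold.IsSmoothEmbedding (𝓡 n) (𝓡 (n + 1)) ∞ e) (he : range e = f ⁻¹' {a}) :
    ConnectedSpace (U.upperCap e hemb he).Capped :=
  (U.isConnectedSum_capped e hemb he).connectedSpace_left (by rw [finrank_euclideanSpace_fin]; omega)

/-- The lower capped side of a connected `M` is connected. [folklore] -/
theorem connectedSpace_lowerCap_capped [ConnectedSpace M]
    (hemb : Manifold.IsSmoothEmbedding (𝓡 n) (𝓡 (n + 1)) ∞ e) (he : range e = f ⁻¹' {a}) :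
    ConnectedSpace (U.lowerCap e hemb he).Capped :=
  (U.isConnectedSum_capped e hemb he).connectedSpace_right (by rw [finrank_euclideanSpace_fin]; omega)

/-- The open upper side `{a < f}` embeds in the upper capped side as the complement of the cap
centre (an open smooth embedding). [folklore] -/
theorem isSmoothEmbedding_inl_upperCap (hemb : Manifold.IsSmoothEmbedding (𝓡 n) (𝓡 (n + 1)) ∞ e)
    (he : range e = f ⁻¹' {a}) :
    Manifold.IsSmoothEmbedding (𝓡 (n + 1)) (𝓡 (n + 1)) ∞ (U.upperCap e hemb he).glueData.inl ∧
      range (U.upperCap e hemb he).glueData.inl = {(U.upperCap e hemb he).glueData.inr 0}ᶜ :=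
  ⟨(U.upperCap e hemb he).glueData.isSmoothEmbedding_inl, (U.upperCap e hemb he).range_inl⟩

/-- The open lower side `{f < a}` embeds in the lower capped side as the complement of the cap
centre. [folklore] -/
theorem isSmoothEmbedding_inl_lowerCap (hemb : Manifold.IsSmoothEmbedding (𝓡 n) (𝓡 (n + 1)) ∞ e)
    (he : range e = f ⁻¹' {a}) :
    Manifold.IsSmoothEmbedding (𝓡 (n + 1)) (𝓡 (n + 1)) ∞ (U.lowerCap e hemb he).glueData.inl ∧
      range (U.lowerCap e hemb he).glueData.inl = {(U.lowerCap e hemb he).glueData.inr 0}ᶜ :=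
  ⟨(U.lowerCap e hemb he).glueData.isSmoothEmbedding_inl, (U.lowerCap e hemb he).range_inl⟩

end LevelUnitField

/-! ### §4 Packaged: a closed manifold with a regular level sphere is a connected sum -/

section Packaged

variable {n : ℕ} {M : Type u} [TopologicalSpace M] [T2Space M] [CompactSpace M]
  [ChartedSpace (𝔼 (n + 1)) M] [IsManifold (𝓡 (n + 1)) ∞ M]

/-- **A closed manifold with a regular level sphere is a connected sum.**  Let `M` be a compact
Hausdorff manifold without boundary modelled on `ℝⁿ⁺¹`, `f : M → ℝ` smooth with regular level
`f⁻¹(a)` (`IsRegularLevel`), and `e : 𝕊ⁿ → M` a smooth embedding with `range e = f⁻¹(a)`.  Then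
there are compact Hausdorff second countable smooth `(n+1)`-manifolds `M₁`, `M₂` (same universe
as `M`) with `IsConnectedSum (𝓡 (n+1)) (𝓡 (n+1)) (𝓡 (n+1)) M₁ M₂ M`, together with open smooth
embeddings `j₁ : {a < f} → M₁`, `j₂ : {f < a} → M₂` of the two open sides whose ranges are
complements of single points (the centres of the capping discs).  Proof: §2–§3 for a unit-speed
field across the level (`IsRegularLevel.exists_levelUnitField`).
[cite: Kosinski1993, Ch. VI §1 (p. 90; Prop. 1.3)] [cite: Milnor1963, Thm. 3.1 and its proof] -/
theorem IsRegularLevel.exists_isConnectedSum_of_sphere_level {f : M → ℝ} {a : ℝ}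
    (h : IsRegularLevel (𝓡 (n + 1)) f a) {e : 𝕊 n → M}
    (hemb : Manifold.IsSmoothEmbedding (𝓡 n) (𝓡 (n + 1)) ∞ e) (he : range e = f ⁻¹' {a}) :
    ∃ (M₁ : Type u) (_ : TopologicalSpace M₁) (_ : T2Space M₁) (_ : SecondCountableTopology M₁)
      (_ : ChartedSpace (𝔼 (n + 1)) M₁) (_ : IsManifold (𝓡 (n + 1)) ∞ M₁) (_ : CompactSpace M₁)
      (M₂ : Type u) (_ : TopologicalSpace M₂) (_ : T2Space M₂) (_ : SecondCountableTopology M₂)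
      (_ : ChartedSpace (𝔼 (n + 1)) M₂) (_ : IsManifold (𝓡 (n + 1)) ∞ M₂) (_ : CompactSpace M₂)
      (j₁ : (⟨{x | a < f x}, isOpen_lt continuous_const h.contMDiff.continuous⟩ :
          TopologicalSpace.Opens M) → M₁) (c₁ : M₁)
      (j₂ : (⟨{x | f x < a}, isOpen_lt h.contMDiff.continuous continuous_const⟩ :
          TopologicalSpace.Opens M) → M₂) (c₂ : M₂),
      IsConnectedSum (𝓡 (n + 1)) (𝓡 (n + 1)) (𝓡 (n + 1)) M₁ M₂ M ∧
      Manifold.IsSmoothEmbedding (𝓡 (n + 1)) (𝓡 (n + 1)) ∞ j₁ ∧ range j₁ = {c₁}ᶜ ∧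
      Manifold.IsSmoothEmbedding (𝓡 (n + 1)) (𝓡 (n + 1)) ∞ j₂ ∧ range j₂ = {c₂}ᶜ ∧
      (ConnectedSpace M → ConnectedSpace M₁ ∧ ConnectedSpace M₂) := by
  obtain ⟨U⟩ := h.exists_levelUnitField
  let D₁ := U.upperCap e hemb he
  let D₂ := U.lowerCap e hemb he
  refine ⟨D₁.Capped, inferInstance, inferInstance, inferInstance, inferInstance, inferInstance,
    inferInstance, D₂.Capped, inferInstance, inferInstance, inferInstance, inferInstance,
    inferInstance, inferInstance,
    D₁.glueData.inl, D₁.glueData.inr 0, D₂.glueData.inl, D₂.glueData.inr 0,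
    U.isConnectedSum_capped e hemb he, ?_, ?_, ?_, ?_, fun _ => ?_⟩
  · exact (U.isSmoothEmbedding_inl_upperCap e hemb he).1
  · exact (U.isSmoothEmbedding_inl_upperCap e hemb he).2
  · exact (U.isSmoothEmbedding_inl_lowerCap e hemb he).1
  · exact (U.isSmoothEmbedding_inl_lowerCap e hemb he).2
  · exact ⟨U.connectedSpace_upperCap_capped e hemb he, U.connectedSpace_lowerCap_capped e hemb he⟩

end Packaged

end Literature.Topology.FourManifolds

end
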